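/-
Copyright (c) 2026. All rights reserved.
Released under Apache 2.0 license as described in the file LICENSE.
Authors: abc-iut cell, prover seat abc-iut-L6-t14 (wave 2).
-/
import Literature.AnabelianGeometry.AbsoluteAnabelian.AbsTopII.PositiveSlopeHenselPolynomial
import HarnessLib

/-!
# [AbsTopII] Lemma 2.1, polynomial special case: the corrected named statement (and its proof)

Successor of the refuted typing
`Literature.AnabelianGeometry.AbsoluteAnabelian.positiveSlopeHensel_polynomial`
(`AbsTopII/PositiveSlopeHensel.lean`; refuted by `not_positiveSlopeHensel_polynomial` in
`AbsTopII/PositiveSlopeHenselCounterexample.lean`): the same statement WITH the printed continuity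
hypothesis of [AbsTopII] Lemma 2.1 p. 31 — the homomorphism `𝒪_k[[Y]] → 𝒪_k[[X]]`, `Yⱼ ↦ fⱼ`, is
continuous, i.e. `fⱼ(0) ∈ 𝔪` — under the name announced to consumers by the L4 layer
(`positiveSlopeHensel_polynomial'`), together with its discharge
`positiveSlopeHensel_polynomial'_holds` by the theorem
`positiveSlopeHensel_polynomial_of_constantCoeff_mem` of `AbsTopII/PositiveSlopeHenselPolynomial.lean`.
Nothing about the IUT corpus is asserted; this is a classical lemma of a refereed paper.
-/

namespace Literature.AnabelianGeometry.AbsoluteAnabelian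

open IsLocalRing

/-- **[AbsTopII] Lemma 2.1 (Positive slope version of Hensel's lemma), polynomial / `k' = k`
special case, corrected statement**: `O` a complete discrete valuation ring (`= 𝒪_k`),
`f₁, …, f_n ∈ O[X₁, …, X_m]` with `fⱼ(0) ∈ 𝔪` (continuity of `Yⱼ ↦ fⱼ`, p. 31: "continuous
`𝒪_k`-algebra homomorphism") and some `n × n` minor of the Jacobian a nonzero polynomial ("the
differential has rank `n` over the fraction field"); then there are `β₀ ∈ 𝔪ⁿ` and `r > 0` such
that every `β' ≡ β₀ (mod 𝔪^r)` is `(fⱼ(x))ⱼ` for some `x ∈ 𝔪^m`. TODO(general form): power series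
`fⱼ ∈ 𝒪_k[[X]]` and the uniformity of `β₀, r` over finite extensions `k'/k`.
[cite: MochizukiAbsTopII2013, Lemma 2.1 p.31] -/
def positiveSlopeHensel_polynomial' : Prop :=
  ∀ (O : Type) [CommRing O] [IsDomain O] [IsDiscreteValuationRing O]
    [IsAdicComplete (IsLocalRing.maximalIdeal O) O] (m n : ℕ) (f : Fin n → MvPolynomial (Fin m) O),
    (∀ j, MvPolynomial.constantCoeff (f j) ∈ IsLocalRing.maximalIdeal O) →
    (∃ S : Fin n ↪ Fin m,
        (Matrix.of fun j k : Fin n => MvPolynomial.pderiv (S k) (f j)).det ≠ 0) →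
      ∃ (β₀ : Fin n → O) (r : ℕ), (∀ j, β₀ j ∈ IsLocalRing.maximalIdeal O) ∧ 0 < r ∧
        ∀ β' : Fin n → O, (∀ j, β' j - β₀ j ∈ IsLocalRing.maximalIdeal O ^ r) →
          ∃ x : Fin m → O, (∀ i, x i ∈ IsLocalRing.maximalIdeal O) ∧
            ∀ j, MvPolynomial.eval x (f j) = β' j

/-- The corrected [AbsTopII] Lemma 2.1 special case HOLDS (discharged by
`positiveSlopeHensel_polynomial_of_constantCoeff_mem`). [cite: MochizukiAbsTopII2013, Lemma 2.1 p.31] -/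
theorem positiveSlopeHensel_polynomial'_holds : positiveSlopeHensel_polynomial' :=
  fun O _ _ _ _ m n f hf0 hS => positiveSlopeHensel_polynomial_of_constantCoeff_mem O m n f hf0 hS

end Literature.AnabelianGeometry.AbsoluteAnabelian
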